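/-
Copyright (c) 2026 the pub-hodgecm-mathlib formalisation cell (harness21).  Prover seat hodgecm-mathlib-LH4-p01 (g9), F3-4 pen under dealer LH4-plan (g8)
(REPRICE-F3-TOT e287c8c1 §3, route (B) «TOT-Λ by over-orders»), LEAD F0P3a-plan (g15) T14-66, 2026-09-02.
-/
import Literature.NumberTheory.Rogawski1990.UnitFundamentalLemmaInertFlickerAlgebraTypeTwo   -- ★ `phiTHM`/`phiTHprimeM` (M,N)-indexed closed forms, `cast_sq_add_one_ne_zero`, `phiTHM_zero_left`; brings ★ `cast_sub_one_ne_zero`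
import HarnessLib

/-!
# The over-order law sums of the type-(2) unit count: the class-I glue sum in closed form equals Flicker's `Φ(t) = phiTHM`
# (Flicker, Canad. J. Math. 50 (1998), Prop. 11 p. 87; Rogawski 1990 §4.9 Prop. 4.9.1 (b))

Topic `NumberTheory/Rogawski1990`; namespace `Literature.NumberTheory.Rogawski1990.Flicker1998` (the closed forms' namespace).  THEOREMS ONLY (pure `ℚ`-algebra: no
definition, no instance, no notation, no `sorry`); count-neutral; kernel lane `--supports stmt-HodgeConjecture-24833`.  Cell `pub/hodgecm-mathlib`, crux H413 =
`stmt-HodgeConjecture-24833`, M6 road «TOT-Λ» file F3-4 (dealer LH4-plan (g8) REPRICE-F3-TOT §3), law memo `F0/P3c/LH4/LH4-p01/g9/o4/f3/F3-LAW.v1.LH4p01g9.md` §3.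
HONEST LABEL: arithmetic only; pays no organ; HC_CM is proved only modulo the 7 printed citations (2 remaining named inputs: hLiu418 = stmt-HodgeConjecture-24832,
h413 = stmt-HodgeConjecture-24833) until rung 0 closes.

THE MATHEMATICS.  On route (B) the number of `γ`-fixed self-dual lattices of class I (`κ = +1`) at exponents `(N, n)` is the sum, over the monogenic glued over-orders
`O_{N″,n″,c} ⊇ 𝒪[γ]` (`N″ ≤ N`, `n″ ∈ {0} ∪ {2m : 1 ≤ m ≤ N″}`), of `q^{N″}` (`n″ = 0`) resp. `g·(q+1)q^{N″+n″−1}` with the glue multiplicities `g = (q−1)q^{m−1}` on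
`m ≤ N″ ≤ N − m` (`2m ≤ M`) and `g = q^{N−N″}` at the single order `N″ = N − M + m` (`⌊M∕2⌋ < m ≤ M`), `M := n∕2` on the even row; summing over `N″` first collapses it to
`(q^{N+1} − 1)∕(q − 1) + (q + 1)·(Σ_{m=1}^{M} q^{N+2m−1} − Σ_{m=1}^{⌊M∕2⌋} q^{4m−2})` (even row `M ≤ N`), resp. with both sums to `⌊N∕2⌋` (deep row `n = 2N+1`).  This file
proves that these two closed structures ARE Flicker's `φ_{T_H}(M, N) = phiTHM q M N` (all four parity branches) — the `κ = +1` half of F3-4; the `κ = −1` half is ★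
`finsum_iSixteenM_eq_phiTHprimeM` term by term (memo §0 (6)).  [cite: Flicker1998UnitaryFL, Prop. 11 p. 87; Prop. 7 p. 84] [cite: Rogawski1990, §4.9 Prop. 4.9.1 (b) p. 55]

## References
* [Flicker1998UnitaryFL] Y. Z. Flicker, *Elementary proof of the fundamental lemma for a unitary group*, Canad. J. Math. 50 (1998), 74–98: Prop. 7 p. 84 (the index weight
  `q^j`), Prop. 11 p. 87 (the closed form `Φ(t)`), Theorem 18 p. 97.
* [Rogawski1990] J. D. Rogawski, *Automorphic Representations of Unitary Groups in Three Variables*, Ann. of Math. Stud. 123 (1990), §4.9 Prop. 4.9.1 (b) p. 55.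
-/

set_option autoImplicit false

open Finset

namespace Literature.NumberTheory.Rogawski1990.Flicker1998

variable {q : ℕ}

/-! ## §1 The two geometric sums of the glue law -/

/-- `Σ_{m < M} q^{N+2m+1} = q^{N+1}·(q^{2M} − 1)∕(q² − 1)`. [cite: Flicker1998UnitaryFL, Prop. 11 p. 87] -/
theorem sum_range_pow_add_two_mul_succ (hq : 1 < q) (M N : ℕ) :
    ∑ m ∈ range M, (q : ℚ) ^ (N + 2 * m + 1) = (q : ℚ) ^ (N + 1) * (((q : ℚ) ^ (2 * M) - 1) / ((q : ℚ) ^ 2 - 1)) := by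
  have hq2 : (q : ℚ) ^ 2 ≠ 1 := by
    have : (1 : ℚ) < (q : ℚ) ^ 2 := one_lt_pow₀ (by exact_mod_cast hq) two_ne_zero
    exact ne_of_gt this
  rw [pow_mul, ← geom_sum_eq hq2 M, Finset.mul_sum]
  refine Finset.sum_congr rfl fun m _ => ?_
  rw [← pow_mul, ← pow_add]; ring_nf

/-- `Σ_{m < P} q^{4m+2} = q²·(q^{4P} − 1)∕(q⁴ − 1)`. [cite: Flicker1998UnitaryFL, Prop. 11 p. 87] -/
theorem sum_range_pow_four_mul_add_two (hq : 1 < q) (P : ℕ) :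
    ∑ m ∈ range P, (q : ℚ) ^ (4 * m + 2) = (q : ℚ) ^ 2 * (((q : ℚ) ^ (4 * P) - 1) / ((q : ℚ) ^ 4 - 1)) := by
  have hq4 : (q : ℚ) ^ 4 ≠ 1 := by
    have : (1 : ℚ) < (q : ℚ) ^ 4 := one_lt_pow₀ (by exact_mod_cast hq) (by norm_num)
    exact ne_of_gt this
  rw [pow_mul, ← geom_sum_eq hq4 P, Finset.mul_sum]
  refine Finset.sum_congr rfl fun m _ => ?_
  rw [← pow_mul, ← pow_add]; ring_nf

/-! ## §2 The class-I over-order sum in closed structure equals `phiTHM` — even row `M ≤ N` -/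

/-- **F3-4 (I), EVEN ROW**: for `M ≤ N`, `(q^{N+1} − 1)∕(q − 1) + (q + 1)·(Σ_{m<M} q^{N+2m+1} − Σ_{m<⌊M∕2⌋} q^{4m+2}) = phiTHM q M N` (Prop. 11's `N₂ < N` branch, both
parities of `M = N₂ + 1`).  [cite: Flicker1998UnitaryFL, Prop. 11 p. 87; Prop. 7 p. 84] [cite: Rogawski1990, §4.9 Prop. 4.9.1 (b) p. 55] -/
theorem overOrderSum_classOne_eq_phiTHM_of_le (hq : 1 < q) {M N : ℕ} (hMN : M ≤ N) :
    ((q : ℚ) ^ (N + 1) - 1) / ((q : ℚ) - 1) +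
        ((q : ℚ) + 1) * (∑ m ∈ range M, (q : ℚ) ^ (N + 2 * m + 1) - ∑ m ∈ range (M / 2), (q : ℚ) ^ (4 * m + 2)) = phiTHM q M N := by
  have h1 := cast_sub_one_ne_zero hq
  have h2 := cast_sq_add_one_ne_zero q
  have hq1 : (q : ℚ) + 1 ≠ 0 := by positivity
  have h21 : (q : ℚ) ^ 2 - 1 ≠ 0 := by
    have h : (q : ℚ) ^ 2 - 1 = ((q : ℚ) - 1) * ((q : ℚ) + 1) := by ring
    rw [h]; exact mul_ne_zero h1 hq1
  have h41 : (q : ℚ) ^ 4 - 1 ≠ 0 := by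
    have h : (q : ℚ) ^ 4 - 1 = ((q : ℚ) ^ 2 - 1) * ((q : ℚ) ^ 2 + 1) := by ring
    rw [h]; exact mul_ne_zero h21 h2
  rw [sum_range_pow_add_two_mul_succ hq, sum_range_pow_four_mul_add_two hq]
  unfold phiTHM
  rw [if_neg (not_lt.2 hMN)]
  obtain ⟨P, rfl | rfl⟩ := Nat.even_or_odd' M
  · -- `M = 2P` even
    rw [if_neg (by omega : ¬ (2 * P) % 2 = 1), show 2 * P / 2 = P by omega]
    field_simp
    ring
  · -- `M = 2P + 1` odd
    rw [if_pos (by omega : (2 * P + 1) % 2 = 1), show (2 * P + 1) / 2 = P by omega]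
    field_simp
    ring

/-! ## §3 The class-I over-order sum in closed structure equals `phiTHM` — deep row `n = 2N + 1` (`M = N + 1`, and any `M > N`) -/

/-- **F3-4 (I), DEEP ROW**: `(q^{N+1} − 1)∕(q − 1) + (q + 1)·(Σ_{m<⌊N∕2⌋} q^{N+2m+1} − Σ_{m<⌊N∕2⌋} q^{4m+2}) = phiTHM q M N` for every `M > N` (Prop. 11's `N ≤ N₂` branch,
both parities of `N`).  [cite: Flicker1998UnitaryFL, Prop. 11 p. 87; Prop. 7 p. 84] [cite: Rogawski1990, §4.9 Prop. 4.9.1 (b) p. 55] -/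
theorem overOrderSum_classOne_eq_phiTHM_of_lt (hq : 1 < q) {M N : ℕ} (hNM : N < M) :
    ((q : ℚ) ^ (N + 1) - 1) / ((q : ℚ) - 1) +
        ((q : ℚ) + 1) * (∑ m ∈ range (N / 2), (q : ℚ) ^ (N + 2 * m + 1) - ∑ m ∈ range (N / 2), (q : ℚ) ^ (4 * m + 2)) = phiTHM q M N := by
  have h1 := cast_sub_one_ne_zero hq
  have h2 := cast_sq_add_one_ne_zero q
  have hq1 : (q : ℚ) + 1 ≠ 0 := by positivity
  have h21 : (q : ℚ) ^ 2 - 1 ≠ 0 := by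
    have h : (q : ℚ) ^ 2 - 1 = ((q : ℚ) - 1) * ((q : ℚ) + 1) := by ring
    rw [h]; exact mul_ne_zero h1 hq1
  have h41 : (q : ℚ) ^ 4 - 1 ≠ 0 := by
    have h : (q : ℚ) ^ 4 - 1 = ((q : ℚ) ^ 2 - 1) * ((q : ℚ) ^ 2 + 1) := by ring
    rw [h]; exact mul_ne_zero h21 h2
  rw [sum_range_pow_add_two_mul_succ hq, sum_range_pow_four_mul_add_two hq]
  unfold phiTHM
  rw [if_pos hNM]
  obtain ⟨P, rfl | rfl⟩ := Nat.even_or_odd' N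
  · -- `N = 2P` even
    rw [if_neg (by omega : ¬ (2 * P) % 2 = 1), show 2 * P / 2 = P by omega]
    field_simp
    ring
  · -- `N = 2P + 1` odd
    rw [if_pos (by omega : (2 * P + 1) % 2 = 1), show (2 * P + 1) / 2 = P by omega]
    field_simp
    ring

end Literature.NumberTheory.Rogawski1990.Flicker1998
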